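import Literature.MathematicalPhysics.QuantumFieldTheory.Balaban1983to89.B15Prop1GaugeLetterLocOfForestPackage
import Literature.MathematicalPhysics.QuantumFieldTheory.Balaban1983to89.B15Prop1GaugeLetterGammaZeroPinB

/-!
# `Balaban1983to89.B15Prop1GaugeLetterLocOfForestPackageB` — [Balaban1985Variational] = «[15]», (4) p. 278, (16)–(18) p. 280 ∕ [Balaban1985RegularSpaces] = «[6]», (1.19) p. 79 ∕
# [Balaban1988Convergent] = «[III]», (2.2) p. 255, (2.13) pp. 256–257 ∕ [Balaban1984PropagatorsII] = «[II]», (2.3) p. 224 (the BOND-level determining datum): THE LOCALISED GAUGE LETTER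
# (σ)_N AT THE ENDPOINT's OBJECTS FROM THE ROOTED TOWER FOREST PACKAGE, OVER A BOND DETERMINING SET `𝔅 : BDetSet P` — print-datum ([II] (2.3)) edition of the lane's
# `B15Prop1GaugeLetterLocOfForestPackage` §1∕§3 (the datum-typed declarations N12's junction of record v14ᴸ uses: `length_le_and_netDisp_of_package`,
# `exists_gaugeLetterLoc_atRecord_of_forestPackage`) — class (γ)∕STRUCTURAL of dag-n12-c's census-by-declaration v2 (bus [DAGN12C-G35]∕[DAGN12C-G36], 2026-08-30)

Honest framing: statement-level skeleton of published theorems with citation tags; proofs where landed; nothing here is a claim about the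
Yang–Mills mass gap.  Cell `pub-ymgap`, seat `pub-ymgap-dag-n12-c` (g36; LANE OWNER N12 = [B15], strategy s1); count-neutral helper of K1⁹ (`stmt-QuantumFields-27364`);
N12 NOT discharged; finite 𝕋⁴ at fixed ε; nothing continuum ∕ OS ∕ mass-gap ∕ Clay.

WHY A SEPARATE EDITION, AND WHAT CHANGES (the (E1)(iii-b) re-attachment, director-ym №338–№358; LOCATED-2 of the lane's census).  The parent keys the ROOT POINTS of the forest package
(`R(𝐁, k)` = the block-tower sites `ι_j c₋`, `ι_j c₊` of the end-points of the bonds `c ∈ bondsOf (𝐁_k(Z) j)`) and the covering clause (Cov) («every site has a member level `J` with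
`B^J z ∈ 𝐁_k(Z)_J`») on the tree's SITE-level `𝐁_k(Z) = Bj M₁ Z k`; over a BOND determining set `𝔅` the root points are the tower sites of the end-points of the MEMBERS `c ∈ 𝔅 j`, and
(Cov) reads «every site has a level `J ≤ k` and a member `c ∈ 𝔅 J` of which `B^J z` is an end-point» (§1ᴮ).  Second, the parent produced the interior letter `hL` of
`B15Prop1GaugeLetterGammaZeroPin.exists_gaugeLetterLoc_atRecord` on the bonds with BOTH end-points in `Ω₁(Z)` from the graded root-free lemma `dist1_gaugeAct_holAtGauge_le_graded` (datum-free,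
used AS IT STANDS) with `Ω := Ω₁(Z)`; over print's [II] (2.3) datum the CROSSING bonds are not pinned (LOCATED-2), the consumer ✓`B15Prop1GaugeLetterGammaZeroPinB.exists_gaugeLetterLoc_atRecord`
asks `hL` on the bonds TOUCHING `Ω₁(Z)`, and this edition supplies it from the same graded lemma on an EXTENDED site set `Ωx` containing both end-points of every bond touching `Ω₁(Z)`
(`hΩx`; e.g. `Ω₁(Z)` with its outer vertex layer): the per-site word budgets, the graded plaquette premise and the root-transporter letter are asked on `Ωx`.  For a crossing bond `⟨x, y⟩`
(`x ∈ Ω₁(Z)`, `y ∈ Λ₀` a root with empty word) the graded lemma's two-root branch applies: the transporter between `root x` and `y` — in print the corridor through the OUTWARD connector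
`⟨B¹x, μ⟩ ∈ Λ₁`, which [II] (2.3) keeps.
RE-KEY NOTE for the junction's generator (dag-n12-d): `length_le_and_netDisp_of_package M₁ Z k path root hpkg hcov z` becomes `… 𝔅 k path root hpkg hcov z` with `hpkg`'s root set
`{z | ∃ j, j ≤ k ∧ ∃ c ∈ 𝔅 j, z = ι_j c₋ ∨ z = ι_j c₊}` and `hcov : ∀ z, ∃ J, J ≤ k ∧ ∃ c ∈ 𝔅 J, B^J z = c₋ ∨ B^J z = c₊`; `exists_gaugeLetterLoc_atRecord_of_forestPackage` loses `hk0`, gains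
`(𝔅) (h𝔅0)` after `Z` and `(Ωx) (hΩx)` before the budgets; `hℓs`∕`hcapS` over `x ∈ Ωx`, `hcapB`∕`hSΩ`∕`hT` over `b₋ ∈ Ωx → b₊ ∈ Ωx`; `hmin : IsMinimizerB …`; `hGN` with two premises (both ends
off); third conjunct of the conclusion on ALL of `N`.  At print's datum the Summits-side package producer (`exists_towerForest_rooted_Bj`) and the root-transporter producer are to be re-keyed
accordingly (their lineage, dag-n12-w3 ∕ dag-n12-d).

CONTENTS (theorems only; no `def`, no `instance`, no `sorry`; namespace `…B15Prop1GaugeLetterLocOfForestPackageB`).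
* §1ᴮ ★ `length_le_and_netDisp_of_package` — (LEN)+(DISP)+(Cov) over `𝔅` ⟹ `|path z| ≤ ℓ_k` and the displacement identity at every site.
* §3ᴮ ★★★ `exists_gaugeLetterLoc_atRecord_of_forestPackage` — (σ)_N at the endpoint's objects over `𝔅` from the package clauses + graded root-free `hP` + `hT` on `Ωx`;
  ★ `uniform_budget_admissible` (`ℓs := ℓ_k` on `Ωx`).  (`exists_rootBox_of_siteBox`, `dist1_gaugeAct_holAtGauge_le_graded`, `tolerance_le_of_target` are datum-free: the parent's.)
HONEST SCOPE: composition by name and lattice bookkeeping; the forest package, the minimiser ([15] Thm 1), the plaquette letter, the root-transporter letter and the geometry of `N`∕`Ωx`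
stay HYPOTHESES; nothing of Bałaban's is asserted; count-neutral; N12 NOT discharged; the YM mass gap (Clay) is NOT proved by any of this — R4 closes only the conditional finite-𝕋⁴ rung
`BalabanLadder.UV`.
-/

noncomputable section

open scoped Matrix.Norms.L2Operator BigOperators

namespace Literature.MathematicalPhysics.QuantumFieldTheory.Balaban1983to89.B15Prop1GaugeLetterLocOfForestPackageB

open T4Continuum GaugeField B15DeterminingSets B15DeterminingSetsB
open T4CubeChartGnomonic (SU2)
open B16Sect1Backgrounds (toMS)
open T4AxialGaugeSmallField (castSite castSite_apply boxPlaqs)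
open B14.Eq213DetSet (maxDomT)
open B14.Eq22Determines (blockIter)
open B5Eq118OneStroke (iterBlockOf)
open Literature.MathematicalPhysics.QuantumFieldTheory.BalabanImbrieJaffe1984to88.BIJ85Eq453GaugeField (qsstarGIter0)
open B15Prop1GaugeLetterLocOfForestPackage (dist1_gaugeAct_holAtGauge_le_graded)
open B15Prop1GaugeLetterGammaZeroPinB (exists_gaugeLetterLoc_atRecord)

variable {P : Params}

/-! ## §1ᴮ  From the package over a bond datum: the uniform length bound and the displacement identity at every site -/

section Package

/-- ★ **(LEN) + (DISP) + (Cov) ⟹ A UNIFORM LENGTH BOUND AND THE DISPLACEMENT IDENTITY AT EVERY SITE — BOND-DATUM EDITION.**  The rooted tower forest package of a bond determining set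
`𝔅` (clauses by shape; root points = the tower sites `ι_j c₋`, `ι_j c₊` of the members `c ∈ 𝔅 j`, `j ≤ k`) gives, at every rooted level `j ≤ k` of a site `z`, `|path z| ≤ Σ_{i≤j}(d(Lⁱ−1)∕2 + 1)`
and `netDisp (word z) ν = z_ν − (root z)_ν`; (Cov) every site has a level `J ≤ k` and a member `c ∈ 𝔅 J` of which `B^J z` is an end-point — so `ι_J(B^J z)` is a root point.  Hence EVERY
site has `|path z| ≤ ℓ_k := Σ_{i≤k}(d(Lⁱ−1)∕2 + 1)` and the displacement identity. [cite: Balaban1988Convergent, (2.2) p.255, (2.13) pp.256–257; Balaban1984PropagatorsII, (2.3) p.224; Balaban1985RegularSpaces, (1.19) p.79 (bookkeeping)] -/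
theorem length_le_and_netDisp_of_package (𝔅 : BDetSet P) (k : ℕ)
    (path : Site P 0 → List (LStep P 0)) (root : Site P 0 → Site P 0)
    (hpkg : ∀ (z : Site P 0) (j : ℕ), j ≤ k →
      embIter j (iterBlockOf j z) ∈ {z : Site P 0 | ∃ j, j ≤ k ∧ ∃ c ∈ 𝔅 j, (z = embIter j c.src ∨ z = embIter j c.tgt)} →
      (∀ s ∈ path z, iterBlockOf j s.bond.src = iterBlockOf j z ∧ iterBlockOf j s.bond.tgt = iterBlockOf j z) ∧
      (path z).length ≤ ∑ i ∈ Finset.range (j + 1), (P.d * ((P.L ^ i - 1) / 2) + 1) ∧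
      (∀ ν, netDisp ((path z).map fun s => (s.bond.dir, s.fwd)) ν = ((z ν).val : ℤ) - ((root z ν).val : ℤ)) ∧
      iterBlockOf j (root z) = iterBlockOf j z)
    (hcov : ∀ z : Site P 0, ∃ J, J ≤ k ∧ ∃ c ∈ 𝔅 J, (iterBlockOf J z = c.src ∨ iterBlockOf J z = c.tgt)) (z : Site P 0) :
    (path z).length ≤ ∑ i ∈ Finset.range (k + 1), (P.d * ((P.L ^ i - 1) / 2) + 1) ∧
      ∀ ν, netDisp ((path z).map fun s => (s.bond.dir, s.fwd)) ν = ((z ν).val : ℤ) - ((root z ν).val : ℤ) := by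
  obtain ⟨J, hJ, c, hc, hz⟩ := hcov z
  have hR : embIter J (iterBlockOf J z) ∈
      {z : Site P 0 | ∃ j, j ≤ k ∧ ∃ c ∈ 𝔅 j, (z = embIter j c.src ∨ z = embIter j c.tgt)} := by
    refine ⟨J, hJ, c, hc, ?_⟩
    rcases hz with hz | hz
    · exact Or.inl (by rw [hz])
    · exact Or.inr (by rw [hz])
  obtain ⟨-, hlen, hdisp, -⟩ := hpkg z J hJ hR
  have hsub : Finset.range (J + 1) ⊆ Finset.range (k + 1) := Finset.range_mono (Nat.succ_le_succ hJ)
  exact ⟨hlen.trans (Finset.sum_le_sum_of_subset hsub), hdisp⟩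

end Package

/-! ## §3ᴮ  The localised gauge letter over a bond datum from the forest package, a GRADED root-free plaquette letter and the root-transporter letter on an extended site set -/

section Assembled

/-- ★★★ **THE LOCALISED GAUGE LETTER (σ)_N AT THE ENDPOINT's OBJECTS, ASSEMBLED — BOND-DATUM EDITION** (graded plaquette premise on an extended site set).  Objects of one instance:
averaging `Node00.avOfRecord F 2 Kt`, class `regMSCoPOfRecord F 2 ν Kt k (maxDomT ν.M₁ Z)`, a bond determining set `𝔅` of height `k ≤ m + K` whose scale-`0` member contains the bonds with
both end-points off `Ω₁(Z)` (`h𝔅0` — print's [II] (2.3) datum at `Z`'s maximal sequence); a datum field `Ṽ` (`= ext V_k`) which is `ρn`-near `1` on a normalised `k`-bond region `𝒞` (`0 ≤ ρn`); a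
(2.12) minimiser `U₀` (`IsMinimizerB`); a bond neighbourhood `N` whose block-crossing bonds with both end-points off `Ω₁(Z)` have `k`-shadows in `𝒞` and which contains the four bonds of every
`Ω₁(Z)`-touching plaquette; the ROOTED TOWER FOREST PACKAGE of `𝔅` by shape (`path`, `root`: (F2) at the members of `𝔅`, «path = walk of its word from its root, ending at the site», the
per-level clause (LEN)∕(DISP), (Cov) over `𝔅`); an EXTENDED site set `Ωx` containing both end-points of every bond touching `Ω₁(Z)` (`hΩx`); PER-SITE word budgets `ℓs` dominating the path
lengths on `Ωx` and PER-BOND transporter budgets `ℓb`, with uniform caps `ℓ`, `ℓT`, `2ℓ + 1 + ℓT <` fine sites per direction; ONE root-free GRADED plaquette letter `PlaqSmallOn S εP U₀` on the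
boxes of radius `R_b + ℓs b₋` around the source site of every bond inside `Ωx`; and the ROOT-TRANSPORTER LETTER with budgets `(ℓb, eT, dG)` between the roots of the two-root bonds inside
`Ωx` ([15] (16)–(18); the crossing bonds are two-root bonds: the root of the `Ω₁`-end vs the `Λ₀`-site).  THEN the tower-axial gauge `σ` carries `hu` at `𝔅`, C1 and `Cin` on ALL of `N` with
the ONE tolerance `max ρn (((2ℓ+1+ℓT)²∕4)·εP + eT + dG)`. [cite: Balaban1985Variational, (2),(4) p.278, Thm 1 (8) p.279, (16)–(18) p.280; Balaban1985RegularSpaces, (1.7) p.77, (1.19) p.79;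
Balaban1988Convergent, (2.2) p.255, (2.11)–(2.13) pp.256–257, (2.16) p.257; Balaban1984PropagatorsII, (2.3) p.224; Balaban1989LargeFieldI, (1.74) p.192, Prop. 1 p.194] -/
theorem exists_gaugeLetterLoc_atRecord_of_forestPackage {F : T4Family} (ν : Node00.Stage7Numerics) (Kt : ℕ) {k : ℕ}
    (hk : k ≤ (F.P Kt).m + (F.P Kt).K) (Z : Set (Site (F.P Kt) 0)) (𝔅 : BDetSet (F.P Kt))
    (h𝔅0 : ∀ b : PBond (F.P Kt) 0, b.src ∉ maxDomT ν.M₁ Z 1 → b.tgt ∉ maxDomT ν.M₁ Z 1 → b ∈ 𝔅 0)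
    -- the rooted tower forest package of `𝔅`, by shape
    (path : Site (F.P Kt) 0 → List (LStep (F.P Kt) 0)) (root : Site (F.P Kt) 0 → Site (F.P Kt) 0)
    (hF2 : ∀ j, j ≤ k → ∀ c ∈ 𝔅 j, path (embIter j c.src) = [] ∧ path (embIter j c.tgt) = [])
    (hwalk : ∀ x, path x = walk (root x) ((path x).map fun s => (s.bond.dir, s.fwd)) ∧
      walkEnd (root x) ((path x).map fun s => (s.bond.dir, s.fwd)) = x)
    (hpkg : ∀ (z : Site (F.P Kt) 0) (j : ℕ), j ≤ k →
      embIter j (iterBlockOf j z) ∈ {z : Site (F.P Kt) 0 | ∃ j, j ≤ k ∧ ∃ c ∈ 𝔅 j, (z = embIter j c.src ∨ z = embIter j c.tgt)} →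
      (∀ s ∈ path z, iterBlockOf j s.bond.src = iterBlockOf j z ∧ iterBlockOf j s.bond.tgt = iterBlockOf j z) ∧
      (path z).length ≤ ∑ i ∈ Finset.range (j + 1), ((F.P Kt).d * (((F.P Kt).L ^ i - 1) / 2) + 1) ∧
      (∀ ν', netDisp ((path z).map fun s => (s.bond.dir, s.fwd)) ν' = ((z ν').val : ℤ) - ((root z ν').val : ℤ)) ∧
      iterBlockOf j (root z) = iterBlockOf j z)
    (hcov : ∀ z : Site (F.P Kt) 0, ∃ J, J ≤ k ∧ ∃ c ∈ 𝔅 J, (iterBlockOf J z = c.src ∨ iterBlockOf J z = c.tgt))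
    -- the extended site set: both end-points of every bond touching `Ω₁(Z)`
    (Ωx : Set (Site (F.P Kt) 0))
    (hΩx : ∀ b : PBond (F.P Kt) 0, (b.src ∈ maxDomT ν.M₁ Z 1 ∨ b.tgt ∈ maxDomT ν.M₁ Z 1) → b.src ∈ Ωx ∧ b.tgt ∈ Ωx)
    -- budgets: per-site word bounds, per-bond transporter bounds, uniform caps (no wrapping)
    (ℓs : Site (F.P Kt) 0 → ℕ) (hℓs : ∀ x ∈ Ωx, (path x).length ≤ ℓs x)
    (ℓb : PBond (F.P Kt) 0 → ℕ) {ℓ ℓT : ℕ} (hcapS : ∀ x ∈ Ωx, ℓs x ≤ ℓ)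
    (hcapB : ∀ b : PBond (F.P Kt) 0, b.src ∈ Ωx → b.tgt ∈ Ωx → ℓb b ≤ ℓT) (hN : 2 * ℓ + 1 + ℓT < (F.P Kt).sitesPerDir 0)
    -- the region-normalised datum and the minimiser
    {ρn : ℝ} (hρn : 0 ≤ ρn)
    (W : GaugeField (F.P Kt) k SU2) (𝒞 : Set (PBond (F.P Kt) k)) (hD : ∀ c ∈ 𝒞, dist1 (W c) ≤ ρn)
    {U₀ : GaugeField (F.P Kt) 0 SU2}
    (hmin : IsMinimizerB (Node00.avOfRecord F 2 Kt) (Node00.regMSCoPOfRecord F 2 ν Kt k (maxDomT ν.M₁ Z)) 𝔅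
      (avgFamily (Node00.avOfRecord F 2 Kt) (qsstarGIter0 k W)) U₀)
    -- geometry of the neighbourhood
    (N : Set (PBond (F.P Kt) 0))
    (hGN : ∀ b ∈ N, b.src ∉ maxDomT ν.M₁ Z 1 → b.tgt ∉ maxDomT ν.M₁ Z 1 → blockIter k b.tgt ≠ blockIter k b.src →
      (⟨blockIter k b.src, b.dir⟩ : PBond (F.P Kt) k) ∈ 𝒞)
    (hN1 : ∀ p : Plaq (F.P Kt) 0, ((⟨p.src, p.μ⟩ : PBond (F.P Kt) 0) ∈ {b : PBond (F.P Kt) 0 | b.src ∈ maxDomT ν.M₁ Z 1} ∨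
        (⟨p.src.shift p.μ, p.ν⟩ : PBond (F.P Kt) 0) ∈ {b : PBond (F.P Kt) 0 | b.src ∈ maxDomT ν.M₁ Z 1} ∨
        (⟨p.src.shift p.ν, p.μ⟩ : PBond (F.P Kt) 0) ∈ {b : PBond (F.P Kt) 0 | b.src ∈ maxDomT ν.M₁ Z 1} ∨
        (⟨p.src, p.ν⟩ : PBond (F.P Kt) 0) ∈ {b : PBond (F.P Kt) 0 | b.src ∈ maxDomT ν.M₁ Z 1}) →
      (⟨p.src, p.μ⟩ : PBond (F.P Kt) 0) ∈ N ∧ (⟨p.src.shift p.μ, p.ν⟩ : PBond (F.P Kt) 0) ∈ N ∧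
        (⟨p.src.shift p.ν, p.μ⟩ : PBond (F.P Kt) 0) ∈ N ∧ (⟨p.src, p.ν⟩ : PBond (F.P Kt) 0) ∈ N)
    -- DISPLAYED: the graded root-free plaquette letter for the minimiser around the bonds inside `Ωx`
    {S : Set (Plaq (F.P Kt) 0)} {εP : ℝ} (hεP : 0 ≤ εP) (hP : PlaqSmallOn S εP U₀)
    (hSΩ : ∀ b : PBond (F.P Kt) 0, b.src ∈ Ωx → b.tgt ∈ Ωx →
      (boxPlaqs (fun κ => ((b.src κ).val : ℤ) - (((2 * max (ℓs b.src) (ℓs b.tgt) + 1 + ℓb b) + ℓs b.src : ℕ) : ℤ))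
          (fun κ => ((b.src κ).val : ℤ) + (((2 * max (ℓs b.src) (ℓs b.tgt) + 1 + ℓb b) + ℓs b.src : ℕ) : ℤ) + 2) : Set (Plaq (F.P Kt) 0)) ⊆ S)
    -- DISPLAYED: the root-transporter letter ([15] (16)–(18) between the roots of the two-root bonds inside `Ωx`)
    {eT dG : ℝ} (heT : 0 ≤ eT) (hdG : 0 ≤ dG)
    (hT : ∀ b : PBond (F.P Kt) 0, b.src ∈ Ωx → b.tgt ∈ Ωx → root b.src ≠ root b.tgt →
      ∃ (Ωw : List (Letter (F.P Kt).d)) (g : SU2), walkEnd (root b.src) Ωw = root b.tgt ∧ Ωw.length ≤ ℓb b ∧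
        dist1 (holAt U₀ (walk (root b.src) Ωw) * g⁻¹) ≤ eT ∧ dist1 g ≤ dG) :
    ∃ σ : GaugeTransf (F.P Kt) 0 SU2,
      (∀ j, j ≤ k → ∀ b ∈ 𝔅 j, toMS σ j b.src = 1 ∧ toMS σ j b.tgt = 1) ∧
        (∀ p : Plaq (F.P Kt) 0, ((⟨p.src, p.μ⟩ : PBond (F.P Kt) 0) ∈ {b : PBond (F.P Kt) 0 | b.src ∈ maxDomT ν.M₁ Z 1} ∨
            (⟨p.src.shift p.μ, p.ν⟩ : PBond (F.P Kt) 0) ∈ {b : PBond (F.P Kt) 0 | b.src ∈ maxDomT ν.M₁ Z 1} ∨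
            (⟨p.src.shift p.ν, p.μ⟩ : PBond (F.P Kt) 0) ∈ {b : PBond (F.P Kt) 0 | b.src ∈ maxDomT ν.M₁ Z 1} ∨
            (⟨p.src, p.ν⟩ : PBond (F.P Kt) 0) ∈ {b : PBond (F.P Kt) 0 | b.src ∈ maxDomT ν.M₁ Z 1}) →
          ‖((gaugeAct σ U₀ ⟨p.src, p.μ⟩ : SU2) : Matrix (Fin 2) (Fin 2) ℂ) - 1‖ ≤ max ρn ((((2 * ℓ + 1 + ℓT : ℕ) : ℝ)) ^ 2 / 4 * εP + eT + dG) ∧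
            ‖((gaugeAct σ U₀ ⟨p.src.shift p.μ, p.ν⟩ : SU2) : Matrix (Fin 2) (Fin 2) ℂ) - 1‖ ≤ max ρn ((((2 * ℓ + 1 + ℓT : ℕ) : ℝ)) ^ 2 / 4 * εP + eT + dG) ∧
            ‖((gaugeAct σ U₀ ⟨p.src.shift p.ν, p.μ⟩ : SU2) : Matrix (Fin 2) (Fin 2) ℂ) - 1‖ ≤ max ρn ((((2 * ℓ + 1 + ℓT : ℕ) : ℝ)) ^ 2 / 4 * εP + eT + dG) ∧
            ‖((gaugeAct σ U₀ ⟨p.src, p.ν⟩ : SU2) : Matrix (Fin 2) (Fin 2) ℂ) - 1‖ ≤ max ρn ((((2 * ℓ + 1 + ℓT : ℕ) : ℝ)) ^ 2 / 4 * εP + eT + dG)) ∧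
        (∀ b ∈ N, ‖((gaugeAct σ U₀ b : SU2) : Matrix (Fin 2) (Fin 2) ℂ) - 1‖ ≤ max ρn ((((2 * ℓ + 1 + ℓT : ℕ) : ℝ)) ^ 2 / 4 * εP + eT + dG)) := by
  have hdisp : ∀ x ∈ Ωx, ∀ ν', netDisp ((path x).map fun s => (s.bond.dir, s.fwd)) ν' = ((x ν').val : ℤ) - ((root x ν').val : ℤ) :=
    fun x _ => (length_le_and_netDisp_of_package 𝔅 k path root hpkg hcov x).2
  have hL : ∀ b : PBond (F.P Kt) 0, (b.src ∈ maxDomT ν.M₁ Z 1 ∨ b.tgt ∈ maxDomT ν.M₁ Z 1) →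
      ‖((gaugeAct (fun x => holAt U₀ (path x)) U₀ b : SU2) : Matrix (Fin 2) (Fin 2) ℂ) - 1‖ ≤ (((2 * ℓ + 1 + ℓT : ℕ) : ℝ)) ^ 2 / 4 * εP + eT + dG := by
    intro b hb
    obtain ⟨hbs, hbt⟩ := hΩx b hb
    exact dist1_gaugeAct_holAtGauge_le_graded U₀ path root hwalk Ωx ℓs hℓs hdisp ℓb hcapS hcapB hN hεP hP hSΩ heT hdG hT hbs hbt
  exact exists_gaugeLetterLoc_atRecord ν Kt hk Z 𝔅 h𝔅0 path hF2 hρn W 𝒞 hD hmin N hGN hN1 hL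

/-- ★ **THE UNIFORM BUDGET `ℓ_k` IS ADMISSIBLE FOR `ℓs` ON ANY SITE SET** (§1ᴮ): the knit may take `ℓs := fun _ => Σ_{i≤k}(d(Lⁱ−1)∕2+1)` on `Ωx` — or the sharper `Γ`-level-graded budgets.
[cite: Balaban1988Convergent, (2.13) pp.256–257 (bookkeeping); Balaban1984PropagatorsII, (2.3) p.224; Balaban1985RegularSpaces, (1.19) p.79] -/
theorem uniform_budget_admissible {F : T4Family} (Kt : ℕ) (𝔅 : BDetSet (F.P Kt)) (k : ℕ) (Ωx : Set (Site (F.P Kt) 0))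
    (path : Site (F.P Kt) 0 → List (LStep (F.P Kt) 0)) (root : Site (F.P Kt) 0 → Site (F.P Kt) 0)
    (hpkg : ∀ (z : Site (F.P Kt) 0) (j : ℕ), j ≤ k →
      embIter j (iterBlockOf j z) ∈ {z : Site (F.P Kt) 0 | ∃ j, j ≤ k ∧ ∃ c ∈ 𝔅 j, (z = embIter j c.src ∨ z = embIter j c.tgt)} →
      (∀ s ∈ path z, iterBlockOf j s.bond.src = iterBlockOf j z ∧ iterBlockOf j s.bond.tgt = iterBlockOf j z) ∧
      (path z).length ≤ ∑ i ∈ Finset.range (j + 1), ((F.P Kt).d * (((F.P Kt).L ^ i - 1) / 2) + 1) ∧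
      (∀ ν', netDisp ((path z).map fun s => (s.bond.dir, s.fwd)) ν' = ((z ν').val : ℤ) - ((root z ν').val : ℤ)) ∧
      iterBlockOf j (root z) = iterBlockOf j z)
    (hcov : ∀ z : Site (F.P Kt) 0, ∃ J, J ≤ k ∧ ∃ c ∈ 𝔅 J, (iterBlockOf J z = c.src ∨ iterBlockOf J z = c.tgt)) :
    ∀ x ∈ Ωx, (path x).length ≤ (fun _ : Site (F.P Kt) 0 => ∑ i ∈ Finset.range (k + 1), ((F.P Kt).d * (((F.P Kt).L ^ i - 1) / 2) + 1)) x :=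
  fun x _ => (length_le_and_netDisp_of_package 𝔅 k path root hpkg hcov x).1

end Assembled

end Literature.MathematicalPhysics.QuantumFieldTheory.Balaban1983to89.B15Prop1GaugeLetterLocOfForestPackageB

end
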